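import Summits.Ventures.CertifiedManyBodySolver.Observables.StiffnessKinematicLeafDensity
import Summits.Ventures.CertifiedManyBodySolver.Observables.StiffnessTLKineticCeilingURay
import Literature.MathematicalPhysics.QuantumLattice.HubbardFermiSeaTangentRowsQuarterFilling
import Summits.Ventures.CertifiedManyBodySolver.Certificates.HubbardSquare_n1o2_upper_qfp_L2_row498
import Literature.MathematicalPhysics.QuantumLattice.HubbardTTPrimeCapCutDualRows
import HarnessLib
import HarnessLib.Audit

/-!
# Ventures/CertifiedManyBodySolver — Certificates/HubbardSquare_U8_n1o2_chord_apriori_r498.lean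

HONEST FRAMING: a-priori CONTROL cells at the quarter-filled point (U, n, t′) = (8, 1/2, 0) of the 2-D Hubbard model — the first certified
double-occupancy cell of any kind at that point — from the certified (8, 1/2, 0) UPPER #498 (`cert_r498_qfp_U8_n1o2_tp0_upper`, E1's plaquette-dressed
quasi-free L2 object, −0.9916692317) and hubbard-fast's NEW premise-free kernel Fermi-sea row at (t′, n) = (0, 1/2)
(`fermiSeaCellRow_tPrime_zero_density_one_div_two : −1.3148398202 ≤ e(1, 0, U, 1/2)`, hubbard-box-eng-1 g4, filed 2026-08-27T03:27Z on this seat's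
WANTED line of 02:57Z); zero compute; CONDITIONAL on #498 BY NAME; the cell's LOWER #463 is a DERIVED n-tangent row without a claim node and is NOT used
(no U″ > 8 row at n = 1/2 exists, so there is no chord docc FLOOR: the kinetic floor is the cap-only `−hi₄₉₈`); a kinetic floor is NOT a stiffness floor;
CONTROL cells at kinematic scale; not informative vs print; not a superconductivity verdict; no phase sentence.

Cell `hubbard-obs` (D-0082 ATLAS PILOT), seat hubbard-obs-menu-2, `prover-hubbard-obs-menu-2-g3-0`; generated by HOME/hubbard-obs-menu-2/tools/
(emit_chord_spec.py → mk_chord_apriori_lean.py; pattern of p487070 / p487729 / p489381). Lemmas: `IsTorusLimitOf.re_expect_docc_le_chord_of_groundState`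
(upper U-chord from the free point U′ = 0, HubbardTTPrimeCapCutDualRows §8), `torusLimit_neg_cap_le_negKinetic`, `torusLimit_negKinetic_le_of_freeEnergyFloor`.
CELLS (10-dp outward) for every torus limit ω of unit (rectN (1/2) L, S^z = 0)-sector ground states of `hubbardTorusTT' L 1 0 8`:
**docc(8, 1/2, 0) ≤ (hi₄₉₈ + 1.3148398202)/8 = 646341177/16000000000 = 0.0403963236** (Hartree n²/4 = 0.0625 excluded by 0.0221; printed D(8, 0.5) ≈ 0.028–0.032
[float, DQMC/VMC-class] inside), **−k(8, 1/2, 0) ∈ [0.9916692317 (cap only), 1.3148398202 (kinematic leaf at n = 1/2, premise-free)]** ⇒ f-sum class floor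
0.2479173079 and kinematic stiffness leaf 0.3287099551 at quarter filling.

References: T. Koma, H. Tasaki, J. Stat. Phys. 76 (1994) 745, §1 [KomaTasaki1994]; D. Ruelle, *Statistical Mechanics* (1969) §3.4 [Ruelle1969]; E. H. Lieb, M. Loss,
Duke Math. J. 71 (1993) 337, §8 [LiebLoss1993]; D. J. Scalapino, S. R. White, S.-C. Zhang, PRB 47 (1993) 7995, §II [ScalapinoWhiteZhang1993].
-/

noncomputable section

namespace Summit.Ventures.CertifiedManyBodySolver.Certificates

open Literature.MathematicalPhysics.QuantumLattice
open Literature.MathematicalPhysics.QuantumLattice.ThermodynamicLimit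
open Literature.Probability.LatticeModels
open Summit.Ventures.CertifiedManyBodySolver.Observables
open Filter Topology HubbardWave0 Finset
open scoped Matrix BigOperators ComplexOrder

/-! ## §1 Point u8_n1o2 = (U, n, t′) = (8, 1/2, 0) -/
/-- **u8_n1o2 docc CEILING by the upper `U`-chord from the free point `U₀ = 0`** (conditional on #498 BY NAME; the cut is hubbard-fast's
kernel Fermi-sea row `-1.3148398202 ≤ e(1, 0, 0, 1/2)`): `Re ω(n↑n↓) ≤ (hi_8 + 1.3148398202)/8 = …0.0403963236` (exact `646341177/16000000000`).
[cite: KomaTasaki1994, §1] [cite: LiebLoss1993, §8, Theorem 8.2] -/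
theorem u8_n1o2_tp0_docc_le_chord_free_r498 (h498 : cert_r498_qfp_U8_n1o2_tp0_upper) :
    ∀ (ω : InfVolFermionState 2) (Ls : ℕ → ℕ) (ψ : ∀ L, Fock (Orb (FermionTorus 2 L))),
      Tendsto Ls atTop atTop →
      (∀ j, IsGroundStateInSector (hubbardTorusTT' (Ls j) 1 0 8) (rectN (1 / 2) (Ls j)) 0 (ψ (Ls j))) →
      (∀ j, star (ψ (Ls j)) ⬝ᵥ ψ (Ls j) = 1) → ω.IsTorusLimitOf ψ Ls →
      (ω.expect ({0} : Finset (Site 2)) (doccAt0 2)).re ≤ (((646341177 / 16000000000 : ℚ)) : ℝ) := by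
  intro ω Ls ψ hLs hψ h1 hω
  have hhi : energyDensityTT' 1 0 8 (1 / 2) ≤ (((-9916692317 / 10000000000 : ℚ)) : ℝ) := by
    have h0 := m3grid_U8_n1o2_tp0_upper_r498_of h498
    exact le_of_le_of_eq h0 (by push_cast; norm_num)
  have hℓ : (-1.3148398202 : ℝ) ≤ energyDensityTT' 1 0 0 (1 / 2) := fermiSeaCellRow_tPrime_zero_density_one_div_two (U := 0) le_rfl
  have h := hω.re_expect_docc_le_chord_of_groundState 1 0 (U := 8) (by norm_num) (n := 1 / 2) (by norm_num) (by norm_num)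
    hLs hψ h1 hhi (U₀ := 0) le_rfl (by norm_num) hℓ
  have hdocc : (ω.expect ({0} : Finset (Site 2)) (doccAt0 2)).re =
      (ω.expect {0} (nAt 0 (mem_singleton_self 0) 0 * nAt 0 (mem_singleton_self 0) 1)).re := rfl
  have hlit : ((((-9916692317 / 10000000000 : ℚ)) : ℝ) - (-1.3148398202 : ℝ)) / (8 - 0) = (((646341177 / 16000000000 : ℚ)) : ℝ) := by
    push_cast; norm_num
  rw [hdocc, ← hlit]; exact h

/-- **u8_n1o2 kinetic FLOOR from the cap alone** (conditional on #498; docc ≥ 0 dropped; zero compute): `−k(ω) ≥ −hi_8 = 0.9916692317`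
for every torus-limit ground state of the (8, 1/2, 0) class (`torusLimit_neg_cap_le_negKinetic`). [cite: KomaTasaki1994, §1] -/
theorem u8_n1o2_tp0_negKinetic_ge_cap_r498 (h498 : cert_r498_qfp_U8_n1o2_tp0_upper) :
    ∀ (ω : InfVolFermionState 2) (Ls : ℕ → ℕ) (ψ : ∀ L, Fock (Orb (FermionTorus 2 L))),
      Tendsto Ls atTop atTop →
      (∀ j, IsGroundStateInSector (hubbardTorusTT' (Ls j) 1 0 8) (rectN (1 / 2) (Ls j)) 0 (ψ (Ls j))) →
      (∀ j, star (ψ (Ls j)) ⬝ᵥ ψ (Ls j) = 1) → ω.IsTorusLimitOf ψ Ls →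
      (((9916692317 / 10000000000 : ℚ)) : ℝ) ≤ -(∑ i : Fin 2, -(1 : ℝ) * ∑ σ : Fin 2,
          ((ω.expect {0, 0 + unitVec i}
              ((cAt 0 (mem_insert_self _ _) σ)ᴴ * cAt (0 + unitVec i) (mem_insert_of_mem (mem_singleton_self _)) σ)).re +
            (ω.expect {0, 0 + unitVec i}
              ((cAt (0 + unitVec i) (mem_insert_of_mem (mem_singleton_self _)) σ)ᴴ * cAt 0 (mem_insert_self _ _) σ)).re)) := by
  intro ω Ls ψ hLs hψ h1 hω
  have hhi : energyDensityTT' 1 0 8 (1 / 2) ≤ (((-9916692317 / 10000000000 : ℚ)) : ℝ) := by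
    have h0 := m3grid_U8_n1o2_tp0_upper_r498_of h498
    exact le_of_le_of_eq h0 (by push_cast; norm_num)
  have h := torusLimit_neg_cap_le_negKinetic (U := 8) (n := 1 / 2) (by norm_num) (by norm_num) (by norm_num) hhi ω Ls ψ hLs hψ h1 hω
  have hlit : (((9916692317 / 10000000000 : ℚ)) : ℝ) = -(((-9916692317 / 10000000000 : ℚ)) : ℝ) := by push_cast; ring
  rw [hlit]; exact h

/-- **u8_n1o2 kinetic CEILING = the density-1/2 kinematic bar** `1.3148398202` (NO premise; hubbard-fast's kernel Fermi-sea row through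
`torusLimit_negKinetic_le_of_freeEnergyFloor`). [cite: LiebLoss1993, §8, Theorem 8.2] -/
theorem u8_n1o2_tp0_negKinetic_le_leaf :
    ∀ (ω : InfVolFermionState 2) (Ls : ℕ → ℕ) (ψ : ∀ L, Fock (Orb (FermionTorus 2 L))),
      Tendsto Ls atTop atTop →
      (∀ j, IsGroundStateInSector (hubbardTorusTT' (Ls j) 1 0 8) (rectN (1 / 2) (Ls j)) 0 (ψ (Ls j))) →
      (∀ j, star (ψ (Ls j)) ⬝ᵥ ψ (Ls j) = 1) → ω.IsTorusLimitOf ψ Ls →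
      -(∑ i : Fin 2, -(1 : ℝ) * ∑ σ : Fin 2,
          ((ω.expect {0, 0 + unitVec i}
              ((cAt 0 (mem_insert_self _ _) σ)ᴴ * cAt (0 + unitVec i) (mem_insert_of_mem (mem_singleton_self _)) σ)).re +
            (ω.expect {0, 0 + unitVec i}
              ((cAt (0 + unitVec i) (mem_insert_of_mem (mem_singleton_self _)) σ)ᴴ * cAt 0 (mem_insert_self _ _) σ)).re)) ≤ (1.3148398202 : ℝ) := by
  intro ω Ls ψ hLs hψ h1 hω
  have hℓ : (-1.3148398202 : ℝ) ≤ energyDensityTT' 1 0 0 (1 / 2) := fermiSeaCellRow_tPrime_zero_density_one_div_two (U := 0) le_rfl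
  have h := torusLimit_negKinetic_le_of_freeEnergyFloor (tp := 0) (U := 8) (n := 1 / 2) (by norm_num) (by norm_num) hℓ
    ω Ls ψ hLs hψ h1 hω
  linarith

end Summit.Ventures.CertifiedManyBodySolver.Certificates

end
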